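import Mathlib
import Literature.NumberTheory.LFunctions.Zhang2022.KnifeEdgeInvisibleTailFamily

/-!
# Length-flatness of Zhang's discrete mean beyond `θ = 1` (F-S2 transfer card, Part E)

Companion to `KnifeEdgeInvisibleTail.lean` (engine) and `KnifeEdgeInvisibleTailFamily.lean` (Part D,
`KnifeEdgeInvisibleTail.tailInvisible`): the deterministic consequence of the invisible tail for the
`Re 𝔠*·‖·‖²·Re ω`-weighted discrete means over the sampled pairs `(ψ, ρ) ∈ Skeleton.idx χ`.

Main result `discMeanFlat`: for `0 < ε < δ`, for all large `D` and every primitive quadratic `χ (mod D)`, IF every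
sampled zero `ρ` has `Re ρ = ½` (displayed HYPOTHESIS — Zhang's Prop. 2.2 output in the (A)-world; nothing here
asserts it), then for every 1-Lipschitz profile `g` with `‖g‖ ≤ 1` the discrete means of the profile polynomials
`Σ_{1≤n<N} χψ(n) g(log n/log P) n^{−ρ}` of lengths `N = ⌈P^{1+δ}⌉` and `N = ⌈P^{1+ε}⌉` differ by at most
`P^{−ε/8}·(absolute short mean + total absolute weight)` — literally the Prop `DiscMeanFlat c' δ ε` of the card's
`Sketch.lean` (its bookkeeping `def`s `profPoly`/`discMean`/`discMeanAbs`/`discWeight` written out; this file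
declares no `def`).  I.e. an (A)-world main term of the normalised discrete mean, if it exists, is constant in the
length beyond `θ = 1`.
WHAT THIS IS NOT: a claim about Theorems 1–2 of arXiv:2211.02515, about Landau–Siegel zeros, or about Parity.
-/

namespace Literature.NumberTheory.LFunctions.Zhang2022.KnifeEdgeDiscMeanFlat

open Finset
open Literature.NumberTheory.LFunctions.Zhang2022.KnifeEdgeInvisibleTail

/-! ## E. Length-flatness of the discrete mean (the card's `DiscMeanFlat c' δ ε`, a theorem for `0 < ε < δ`)

Deterministic consequence of Part D and the flatness inequality `abs_sum_mul_norm_sq_perturb_le`: over the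
sampled pairs `(ψ, ρ)` (`Skeleton.idx χ`), once every sampled `ρ` has `Re ρ = ½` (Zhang's Prop. 2.2 output under
(A), carried as a HYPOTHESIS exactly as in the card), the `Re 𝔠*·|·|²·Re ω`-weighted discrete means of the profile
polynomials of lengths `⌈P^{1+δ}⌉` and `⌈P^{1+ε}⌉` differ by at most `P^{−ε/8}·(absolute short mean + total
absolute weight)`.  No `def` is introduced: the card's `profPoly`/`discMean`/`discMeanAbs`/`discWeight` are
written out, and `example : DiscMeanFlat c' δ ε := discMeanFlat c' hε hεδ` elaborates against the Sketch. -/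

section Flat

open Skeleton

/-- `⌈exp L₀⌉ ≤ D` gives `L₀ ≤ 𝓛 = log D`. [folklore] -/
private theorem le_ell_of_ceil_exp_le {L₀ : ℝ} {D : ℕ} (hD : ⌈Real.exp L₀⌉₊ ≤ D) : L₀ ≤ ell D := by
  have h : Real.exp L₀ ≤ (D : ℝ) := (Nat.le_ceil _).trans (by exact_mod_cast hD)
  exact (Real.le_log_iff_exp_le (lt_of_lt_of_le (Real.exp_pos _) h)).mpr h


/-- A sampled zero `ρ ∈ 𝔷(ψ)` has `|Im ρ| ≤ 8t₀` (`|Im ρ − 2πt₀| < 𝓛₁ = 𝓛⁴⁰⁵ ≤ t₀ = 𝓛⁵¹⁹`, `2π + 1 < 8`).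
[cite: Zhang2022LandauSiegel, §2 (2.8), (2.14)] -/
private theorem abs_im_le_of_mem_zeroSet {D : ℕ} (x : Chr D) (hℓ1 : 1 ≤ ell D) {ρ : ℂ}
    (hρ : ρ ∈ zeroSet D x) : |ρ.im| ≤ 8 * t0 D := by
  have h1 : |ρ.im - 2 * Real.pi * t0 D| < ell1 D := hρ.2.1
  have h2 : ell1 D ≤ t0 D := by
    simp only [ell1, t0]; exact pow_le_pow_right₀ hℓ1 (by norm_num)
  have h3 : 0 ≤ t0 D := by simp only [t0]; positivity
  have hπ : Real.pi < 3.15 := Real.pi_lt_d2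
  have hπt : Real.pi * t0 D ≤ 3.15 * t0 D := mul_le_mul_of_nonneg_right hπ.le h3
  have hπt0 : 0 ≤ Real.pi * t0 D := mul_nonneg Real.pi_pos.le h3
  have h4 := abs_lt.mp h1
  rw [abs_le]; constructor <;> linarith

/-- `2 ≤ P^{ε/4}` once `𝓛 ≥ 4/ε` (`P = e^{𝓛⁹}`). [folklore] -/
private theorem two_le_bigP_rpow {D : ℕ} {ε : ℝ} (hε : 0 < ε) (hℓ1 : 1 ≤ ell D) (hℓ4ε : 4 / ε ≤ ell D) :
    (2 : ℝ) ≤ bigP D ^ (ε / 4) := by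
  have hℓ9 : ell D ≤ ell D ^ 9 := by
    calc ell D = ell D ^ 1 := (pow_one _).symm
      _ ≤ ell D ^ 9 := pow_le_pow_right₀ hℓ1 (by norm_num)
  have h1 : bigP D ^ (ε / 4) = Real.exp (ell D ^ 9 * (ε / 4)) := by rw [bigP, ← Real.exp_mul]
  have h2 : ell D ^ 9 * (ε / 4) + 1 ≤ Real.exp (ell D ^ 9 * (ε / 4)) := Real.add_one_le_exp _
  have h3 : 4 ≤ ε * ell D := by rwa [div_le_iff₀' hε] at hℓ4ε
  have h4 : ε * ell D ≤ ε * ell D ^ 9 := mul_le_mul_of_nonneg_left hℓ9 hε.le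
  rw [h1]; nlinarith

/-- The block `(⌈P^{1+ε}⌉ − 1, ·]` starts beyond `P^{1+3ε/4}` once `P^{ε/4} ≥ 2`. [folklore] -/
private theorem rpow_le_ceil_sub_one {P ε : ℝ} (hP : 0 < P) (hP1 : 1 ≤ P) (hε : 0 < ε) (h2 : 2 ≤ P ^ (ε / 4)) :
    P ^ (1 + 3 * ε / 4) ≤ ((⌈P ^ (1 + ε)⌉₊ - 1 : ℕ) : ℝ) := by
  have hN1 : 1 ≤ ⌈P ^ (1 + ε)⌉₊ := Nat.one_le_ceil_iff.mpr (Real.rpow_pos_of_pos hP _)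
  rw [Nat.cast_sub hN1, Nat.cast_one]
  have h1 : P ^ (1 + ε) ≤ (⌈P ^ (1 + ε)⌉₊ : ℝ) := Nat.le_ceil _
  have h2' : P ^ (1 + ε) = P ^ (1 + 3 * ε / 4) * P ^ (ε / 4) := by
    rw [← Real.rpow_add hP]; ring_nf
  have h3 : 1 ≤ P ^ (1 + 3 * ε / 4) := Real.one_le_rpow hP1 (by linarith)
  nlinarith

/-- The coefficient comparison of the flatness step: `(Cv³)²/v² + (Cv³)² ≤ v²` for `0 < v ≤ 1`, `2C²v² ≤ 1`.
[folklore] -/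
private theorem flat_coef {C v : ℝ} (hv0 : 0 < v) (hv1 : v ≤ 1) (h2C : 2 * C ^ 2 * v ^ 2 ≤ 1) :
    (C * v ^ 3) ^ 2 / v ^ 2 + (C * v ^ 3) ^ 2 ≤ v ^ 2 := by
  have hv2 : 0 < v ^ 2 := pow_pos hv0 2
  have e1 : (C * v ^ 3) ^ 2 / v ^ 2 = C ^ 2 * v ^ 4 := by
    rw [div_eq_iff hv2.ne']; ring
  rw [e1]
  have hv4 : v ^ 4 ≤ v ^ 2 := pow_le_pow_of_le_one hv0.le hv1 (by norm_num)
  have hv6 : v ^ 6 ≤ v ^ 4 := pow_le_pow_of_le_one hv0.le hv1 (by norm_num)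
  have hC2 : 0 ≤ C ^ 2 := sq_nonneg C
  have e2 : (C * v ^ 3) ^ 2 = C ^ 2 * v ^ 6 := by ring
  rw [e2]
  nlinarith [mul_le_mul_of_nonneg_left hv6 hC2, mul_le_mul_of_nonneg_left hv4 hC2, pow_pos hv0 4]

/-- `2C²v² ≤ 1` for `v = e^{−ε𝓛⁹/16}` once `𝓛 ≥ 16C²/ε`. [folklore] -/
private theorem two_C_sq_v_sq_le {C ε ℓ : ℝ} (hε : 0 < ε) (hℓ1 : 1 ≤ ℓ) (hℓC : 16 * C ^ 2 / ε ≤ ℓ) :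
    2 * C ^ 2 * Real.exp (ℓ ^ 9 * (-(ε / 16))) ^ 2 ≤ 1 := by
  have hℓ9 : ℓ ≤ ℓ ^ 9 := by
    calc ℓ = ℓ ^ 1 := (pow_one _).symm
      _ ≤ ℓ ^ 9 := pow_le_pow_right₀ hℓ1 (by norm_num)
  have h1 : Real.exp (ℓ ^ 9 * (-(ε / 16))) ^ 2 = Real.exp (-(ℓ ^ 9 * (ε / 8))) := by
    rw [← Real.exp_nat_mul]; congr 1; push_cast; ring
  have h2 : ℓ ^ 9 * (ε / 8) + 1 ≤ Real.exp (ℓ ^ 9 * (ε / 8)) := Real.add_one_le_exp _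
  have h3 : 16 * C ^ 2 ≤ ε * ℓ := by rwa [div_le_iff₀' hε] at hℓC
  have h4 : ε * ℓ ≤ ε * ℓ ^ 9 := mul_le_mul_of_nonneg_left hℓ9 hε.le
  have h5 : 2 * C ^ 2 ≤ Real.exp (ℓ ^ 9 * (ε / 8)) := by nlinarith
  rw [h1, Real.exp_neg, ← div_eq_mul_inv, div_le_one (Real.exp_pos _)]
  exact h5

/-- **Length-flatness of the discrete mean** (literally the Prop `DiscMeanFlat c' δ ε` of the F-S2 transfer
card's `Sketch.lean`, its four bookkeeping `def`s `profPoly`/`discMean`/`discMeanAbs`/`discWeight` unfolded,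
for `0 < ε < δ`): for all large `D` and every primitive quadratic `χ (mod D)`, IF every sampled zero has
`Re ρ = ½`, then for every 1-Lipschitz profile `g` with `‖g‖ ≤ 1`,
`|discMean(length ⌈P^{1+δ}⌉) − discMean(length ⌈P^{1+ε}⌉)| ≤ P^{−ε/8}·(discMeanAbs(length ⌈P^{1+ε}⌉) + discWeight)`
where `discMean F = Σ_{(ψ,ρ) ∈ idx χ} Re 𝔠*(ρ,ψ)·‖F(ψ,ρ)‖²·Re ω(ρ)`, `discMeanAbs` has `|Re 𝔠* Re ω|` instead,
`discWeight = Σ |Re 𝔠* Re ω|`, and the profile polynomial is `Σ_{1≤n<N} χψ(n) g(log n/log P) n^{−ρ}`.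
Proof: `tailInvisible` with `ε' = 3ε/4` bounds the block `⌈P^{1+ε}⌉ ≤ n < ⌈P^{1+δ}⌉` by `τ = C·P^{−3ε/16}` at
every sampled `ρ` (`|Im ρ| ≤ 2πt₀ + 𝓛₁ ≤ 8t₀`), and `abs_sum_mul_norm_sq_perturb_le` with `η = P^{−ε/8}` gives
the claim once `2C² ≤ P^{ε/8}`.  The (A)-world content sits entirely in the HYPOTHESIS `Re ρ = ½`; nothing here
asserts it. [cite: Zhang2022LandauSiegel, §2 (2.16)–(2.20); §8 Lemma 8.1] -/
theorem discMeanFlat (c' : ℝ) {δ ε : ℝ} (hε : 0 < ε) (hεδ : ε < δ) :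
    Skeleton.ForAllLarge fun D _ χ =>
      (∀ i ∈ Skeleton.idx χ, (i.2).re = 1 / 2) →
        ∀ g : ℝ → ℂ, LipschitzWith 1 g → (∀ z, ‖g z‖ ≤ 1) →
          |(∑ i ∈ Skeleton.idx χ, (Skeleton.cstar c' D i.1 i.2).re *
                ‖∑ n ∈ Finset.Ico 1 ⌈Skeleton.bigP D ^ (1 + δ)⌉₊,
                    Skeleton.pc χ i.1 n * g (Real.log n / Real.log (Skeleton.bigP D)) * (n : ℂ) ^ (-i.2)‖ ^ 2 *
                  (Skeleton.omegaW D i.2).re) -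
              (∑ i ∈ Skeleton.idx χ, (Skeleton.cstar c' D i.1 i.2).re *
                ‖∑ n ∈ Finset.Ico 1 ⌈Skeleton.bigP D ^ (1 + ε)⌉₊,
                    Skeleton.pc χ i.1 n * g (Real.log n / Real.log (Skeleton.bigP D)) * (n : ℂ) ^ (-i.2)‖ ^ 2 *
                  (Skeleton.omegaW D i.2).re)| ≤
            Skeleton.bigP D ^ (-(ε / 8)) *
              ((∑ i ∈ Skeleton.idx χ, |(Skeleton.cstar c' D i.1 i.2).re * (Skeleton.omegaW D i.2).re| *
                  ‖∑ n ∈ Finset.Ico 1 ⌈Skeleton.bigP D ^ (1 + ε)⌉₊,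
                      Skeleton.pc χ i.1 n * g (Real.log n / Real.log (Skeleton.bigP D)) * (n : ℂ) ^ (-i.2)‖ ^ 2) +
                ∑ i ∈ Skeleton.idx χ, |(Skeleton.cstar c' D i.1 i.2).re * (Skeleton.omegaW D i.2).re|) := by
  have hε' : 0 < 3 * ε / 4 := by linarith
  have hδ : 0 < δ := by linarith
  obtain ⟨C, hC, D₁, hT⟩ := tailInvisible hε' hδ
  refine ⟨max D₁ ⌈Real.exp (max 1 (max (4 / ε) (16 * C ^ 2 / ε)))⌉₊, ?_⟩
  intro D _ χ hD hquad hprim hcrit g hg hg1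
  have hD₁ : D₁ ≤ D := le_trans (le_max_left _ _) hD
  have hT' := hT D χ hD₁ hquad hprim
  -- parameters
  have hℓ : max 1 (max (4 / ε) (16 * C ^ 2 / ε)) ≤ ell D :=
    le_ell_of_ceil_exp_le (le_trans (le_max_right _ _) hD)
  have hℓ1 : 1 ≤ ell D := le_trans (le_max_left _ _) hℓ
  have hℓ4ε : 4 / ε ≤ ell D := le_trans (le_trans (le_max_left _ _) (le_max_right _ _)) hℓ
  have hℓC : 16 * C ^ 2 / ε ≤ ell D := le_trans (le_trans (le_max_right _ _) (le_max_right _ _)) hℓ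
  have hℓ0 : 0 < ell D := by linarith
  have hℓ9 : ell D ≤ ell D ^ 9 := by
    calc ell D = ell D ^ 1 := (pow_one _).symm
      _ ≤ ell D ^ 9 := pow_le_pow_right₀ hℓ1 (by norm_num)
  have hP : 0 < bigP D := Real.exp_pos _
  have hP1 : 1 ≤ bigP D := by rw [bigP]; exact Real.one_le_exp (by positivity)
  have hlogP : Real.log (bigP D) = ell D ^ 9 := by rw [bigP, Real.log_exp]
  have hlogPpos : 0 < Real.log (bigP D) := by rw [hlogP]; positivity
  -- the two lengths and the block `(X, Y]`
  have hNε1 : 1 ≤ ⌈bigP D ^ (1 + ε)⌉₊ := Nat.one_le_ceil_iff.mpr (Real.rpow_pos_of_pos hP _)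
  have hNεδ : ⌈bigP D ^ (1 + ε)⌉₊ ≤ ⌈bigP D ^ (1 + δ)⌉₊ :=
    Nat.ceil_mono (Real.rpow_le_rpow_of_exponent_le hP1 (by linarith))
  have hNδ1 : 1 ≤ ⌈bigP D ^ (1 + δ)⌉₊ := le_trans hNε1 hNεδ
  have hXs : ⌈bigP D ^ (1 + ε)⌉₊ - 1 + 1 = ⌈bigP D ^ (1 + ε)⌉₊ := Nat.sub_add_cancel hNε1
  have hYs : ⌈bigP D ^ (1 + δ)⌉₊ - 1 + 1 = ⌈bigP D ^ (1 + δ)⌉₊ := Nat.sub_add_cancel hNδ1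
  have hXY : ⌈bigP D ^ (1 + ε)⌉₊ - 1 ≤ ⌈bigP D ^ (1 + δ)⌉₊ - 1 := Nat.sub_le_sub_right hNεδ 1
  have hXr : bigP D ^ (1 + 3 * ε / 4) ≤ ((⌈bigP D ^ (1 + ε)⌉₊ - 1 : ℕ) : ℝ) :=
    rpow_le_ceil_sub_one hP hP1 hε (two_le_bigP_rpow hε hℓ1 hℓ4ε)
  have hYr : (((⌈bigP D ^ (1 + δ)⌉₊ - 1 : ℕ)) : ℝ) ≤ bigP D ^ (1 + δ) := by
    rw [Nat.cast_sub hNδ1, Nat.cast_one]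
    have := Nat.ceil_lt_add_one (Real.rpow_nonneg hP.le (1 + δ))
    linarith
  -- the tail block at a sampled pair, and its bound `τ = C·v³`, `v = P^{−ε/16}`
  set X : ℕ := ⌈bigP D ^ (1 + ε)⌉₊ - 1 with hXdef
  set Y : ℕ := ⌈bigP D ^ (1 + δ)⌉₊ - 1 with hYdef
  set t : ((_ : Chr D) × ℂ) → ℂ := fun i =>
    ∑ n ∈ Finset.Ioc X Y, Skeleton.pc χ i.1 n * g (Real.log n / Real.log (Skeleton.bigP D)) *
      (n : ℂ) ^ (-i.2) with htdef
  set v : ℝ := Real.exp (ell D ^ 9 * (-(ε / 16))) with hvdef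
  have hv0 : 0 < v := Real.exp_pos _
  have hv1 : v ≤ 1 := by
    rw [hvdef]; apply Real.exp_le_one_iff.mpr
    have : 0 ≤ ell D ^ 9 * (ε / 16) := by positivity
    linarith
  have hPτ : bigP D ^ (-(3 * ε / 4 / 4)) = v ^ 3 := by
    rw [bigP, ← Real.exp_mul, hvdef, ← Real.exp_nat_mul]; congr 1; push_cast; ring
  have hPη : bigP D ^ (-(ε / 8)) = v ^ 2 := by
    rw [bigP, ← Real.exp_mul, hvdef, ← Real.exp_nat_mul]; congr 1; push_cast; ring
  have hτ : ∀ i ∈ Skeleton.idx χ, ‖t i‖ ≤ C * v ^ 3 := by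
    intro i hi
    have hi' : i.1 ∈ finsetOf (PsiOne χ) ∧ i.2 ∈ finsetOf (zeroSet D i.1) := by
      simpa only [idx, Finset.mem_sigma] using hi
    have hz : i.2 ∈ zeroSet D i.1 := mem_of_mem_finsetOf hi'.2
    have hre : i.2.re = 1 / 2 := hcrit i hi
    have him : |i.2.im| ≤ 8 * t0 D := abs_im_le_of_mem_zeroSet i.1 hℓ1 hz
    have h1σ : 1 / 2 - 1 / Real.log (bigP D) ≤ i.2.re := by
      rw [hre]; have := one_div_pos.mpr hlogPpos; linarith
    have h2σ : i.2.re ≤ 2 := by rw [hre]; norm_num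
    have := hT' i.1 g hg hg1 i.2 h1σ h2σ him X Y hXr hXY hYr
    rw [hPτ] at this
    exact this
  -- the long polynomial = the short one + the block
  have hsplit : ∀ i : ((_ : Chr D) × ℂ),
      (∑ n ∈ Finset.Ico 1 ⌈bigP D ^ (1 + δ)⌉₊,
          pc χ i.1 n * g (Real.log n / Real.log (bigP D)) * (n : ℂ) ^ (-i.2)) =
        (∑ n ∈ Finset.Ico 1 ⌈bigP D ^ (1 + ε)⌉₊,
          pc χ i.1 n * g (Real.log n / Real.log (bigP D)) * (n : ℂ) ^ (-i.2)) + t i := by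
    intro i
    simp only [htdef]
    rw [← Finset.sum_Ico_consecutive _ hNε1 hNεδ, ← hXs, ← hYs, Finset.Ico_add_one_add_one_eq_Ioc]
  -- the flatness inequality
  have key := abs_sum_mul_norm_sq_perturb_le (Skeleton.idx χ)
    (fun i : ((_ : Chr D) × ℂ) => (cstar c' D i.1 i.2).re * (omegaW D i.2).re)
    (fun i : ((_ : Chr D) × ℂ) => ∑ n ∈ Finset.Ico 1 ⌈bigP D ^ (1 + ε)⌉₊,
      pc χ i.1 n * g (Real.log n / Real.log (bigP D)) * (n : ℂ) ^ (-i.2)) t (pow_pos hv0 2) hτ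
  have hdiff : (∑ i ∈ Skeleton.idx χ, (cstar c' D i.1 i.2).re *
        ‖∑ n ∈ Finset.Ico 1 ⌈bigP D ^ (1 + δ)⌉₊,
            pc χ i.1 n * g (Real.log n / Real.log (bigP D)) * (n : ℂ) ^ (-i.2)‖ ^ 2 * (omegaW D i.2).re) -
      (∑ i ∈ Skeleton.idx χ, (cstar c' D i.1 i.2).re *
        ‖∑ n ∈ Finset.Ico 1 ⌈bigP D ^ (1 + ε)⌉₊,
            pc χ i.1 n * g (Real.log n / Real.log (bigP D)) * (n : ℂ) ^ (-i.2)‖ ^ 2 * (omegaW D i.2).re) =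
      ∑ i ∈ Skeleton.idx χ, (cstar c' D i.1 i.2).re * (omegaW D i.2).re *
        (‖(∑ n ∈ Finset.Ico 1 ⌈bigP D ^ (1 + ε)⌉₊,
              pc χ i.1 n * g (Real.log n / Real.log (bigP D)) * (n : ℂ) ^ (-i.2)) + t i‖ ^ 2 -
          ‖∑ n ∈ Finset.Ico 1 ⌈bigP D ^ (1 + ε)⌉₊,
              pc χ i.1 n * g (Real.log n / Real.log (bigP D)) * (n : ℂ) ^ (-i.2)‖ ^ 2) := by
    rw [← Finset.sum_sub_distrib]
    refine Finset.sum_congr rfl fun i _ => ?_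
    rw [hsplit i]; ring
  rw [hdiff, hPη]
  refine key.trans ?_
  -- coefficients: `(C v³)²/v² + (C v³)² ≤ v²` once `2C²v² ≤ 1`, i.e. `2C² ≤ P^{ε/8}`
  have hW0 : 0 ≤ ∑ i ∈ Skeleton.idx χ, |(cstar c' D i.1 i.2).re * (omegaW D i.2).re| :=
    Finset.sum_nonneg fun _ _ => abs_nonneg _
  have hA0 : 0 ≤ ∑ i ∈ Skeleton.idx χ, |(cstar c' D i.1 i.2).re * (omegaW D i.2).re| *
      ‖∑ n ∈ Finset.Ico 1 ⌈bigP D ^ (1 + ε)⌉₊,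
          pc χ i.1 n * g (Real.log n / Real.log (bigP D)) * (n : ℂ) ^ (-i.2)‖ ^ 2 :=
    Finset.sum_nonneg fun _ _ => mul_nonneg (abs_nonneg _) (sq_nonneg _)
  have h2C : 2 * C ^ 2 * v ^ 2 ≤ 1 := two_C_sq_v_sq_le hε hℓ1 hℓC
  have hcoef : (C * v ^ 3) ^ 2 / v ^ 2 + (C * v ^ 3) ^ 2 ≤ v ^ 2 := flat_coef hv0 hv1 h2C
  have hfin := mul_le_mul_of_nonneg_right hcoef hW0
  linarith

/-! ## F. Length-flatness for the NON-SMOOTH class: profiles of bounded variation (LS programme, family B-multi)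

Cell `landau-siegel` (rung F-S3), sub-cell §B-multi, registry row «E-multi-farjump» (B-multi/EDLIST.md multi-E3):
the same deterministic consequence, now from `tailInvisible_bv` — the profile need only be bounded (`‖g‖ ≤ B`) with
total variation `≤ V` on `[1, 1+δ]` (jumps, kinks, sharp cut-offs allowed); the weight term picks up the factor
`(B + V)²`.  So for every piecewise design profile the (A)-world main term of the normalised discrete mean, if it
exists, is constant in the length beyond `θ = 1`: a feature placed at `z ≥ 1 + ε` is invisible whether smooth or not. -/

/-- **Length-flatness of the discrete mean for bounded-variation profiles** (non-smooth companion of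
`discMeanFlat`, `0 < ε < δ`): for all large `D` and every primitive quadratic `χ (mod D)`, IF every sampled zero has
`Re ρ = ½` (displayed HYPOTHESIS, as in `discMeanFlat`), then for every profile `g` with `‖g‖ ≤ B` and total
variation `eVariationOn g [1, 1+δ] ≤ V` (`B, V ≥ 0`; no continuity asked),
`|discMean(length ⌈P^{1+δ}⌉) − discMean(length ⌈P^{1+ε}⌉)| ≤ P^{−ε/8}·(discMeanAbs(length ⌈P^{1+ε}⌉) + (B+V)²·discWeight)`
(notation of `discMeanFlat`).  Proof: `tailInvisible_bv` with `ε' = 3ε/4` bounds the block by `τ = C(B+V)P^{−3ε/16}`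
at every sampled `ρ`, then `abs_sum_mul_norm_sq_perturb_le` with `η = P^{−ε/8}`, once `2C² ≤ P^{ε/8}`.
[cite: Zhang2022LandauSiegel, §2 (2.16)–(2.20); §8 Lemma 8.1] -/
theorem discMeanFlat_bv (c' : ℝ) {δ ε : ℝ} (hε : 0 < ε) (hεδ : ε < δ) :
    Skeleton.ForAllLarge fun D _ χ =>
      (∀ i ∈ Skeleton.idx χ, (i.2).re = 1 / 2) →
        ∀ (g : ℝ → ℂ) (B V : ℝ), 0 ≤ B → 0 ≤ V → (∀ z, ‖g z‖ ≤ B) →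
          eVariationOn g (Set.Icc 1 (1 + δ)) ≤ ENNReal.ofReal V →
          |(∑ i ∈ Skeleton.idx χ, (Skeleton.cstar c' D i.1 i.2).re *
                ‖∑ n ∈ Finset.Ico 1 ⌈Skeleton.bigP D ^ (1 + δ)⌉₊,
                    Skeleton.pc χ i.1 n * g (Real.log n / Real.log (Skeleton.bigP D)) * (n : ℂ) ^ (-i.2)‖ ^ 2 *
                  (Skeleton.omegaW D i.2).re) -
              (∑ i ∈ Skeleton.idx χ, (Skeleton.cstar c' D i.1 i.2).re *
                ‖∑ n ∈ Finset.Ico 1 ⌈Skeleton.bigP D ^ (1 + ε)⌉₊,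
                    Skeleton.pc χ i.1 n * g (Real.log n / Real.log (Skeleton.bigP D)) * (n : ℂ) ^ (-i.2)‖ ^ 2 *
                  (Skeleton.omegaW D i.2).re)| ≤
            Skeleton.bigP D ^ (-(ε / 8)) *
              ((∑ i ∈ Skeleton.idx χ, |(Skeleton.cstar c' D i.1 i.2).re * (Skeleton.omegaW D i.2).re| *
                  ‖∑ n ∈ Finset.Ico 1 ⌈Skeleton.bigP D ^ (1 + ε)⌉₊,
                      Skeleton.pc χ i.1 n * g (Real.log n / Real.log (Skeleton.bigP D)) * (n : ℂ) ^ (-i.2)‖ ^ 2) +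
                (B + V) ^ 2 *
                  ∑ i ∈ Skeleton.idx χ, |(Skeleton.cstar c' D i.1 i.2).re * (Skeleton.omegaW D i.2).re|) := by
  have hε' : 0 < 3 * ε / 4 := by linarith
  have hδ : 0 < δ := by linarith
  obtain ⟨C, hC, D₁, hT⟩ := tailInvisible_bv hε' hδ
  refine ⟨max D₁ ⌈Real.exp (max 1 (max (4 / ε) (16 * C ^ 2 / ε)))⌉₊, ?_⟩
  intro D _ χ hD hquad hprim hcrit g B V hB hV hgB hvar
  have hD₁ : D₁ ≤ D := le_trans (le_max_left _ _) hD
  have hT' := hT D χ hD₁ hquad hprim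
  -- parameters
  have hℓ : max 1 (max (4 / ε) (16 * C ^ 2 / ε)) ≤ ell D :=
    le_ell_of_ceil_exp_le (le_trans (le_max_right _ _) hD)
  have hℓ1 : 1 ≤ ell D := le_trans (le_max_left _ _) hℓ
  have hℓ4ε : 4 / ε ≤ ell D := le_trans (le_trans (le_max_left _ _) (le_max_right _ _)) hℓ
  have hℓC : 16 * C ^ 2 / ε ≤ ell D := le_trans (le_trans (le_max_right _ _) (le_max_right _ _)) hℓ
  have hℓ0 : 0 < ell D := by linarith
  have hP : 0 < bigP D := Real.exp_pos _
  have hP1 : 1 ≤ bigP D := by rw [bigP]; exact Real.one_le_exp (by positivity)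
  have hlogP : Real.log (bigP D) = ell D ^ 9 := by rw [bigP, Real.log_exp]
  have hlogPpos : 0 < Real.log (bigP D) := by rw [hlogP]; positivity
  -- the two lengths and the block `(X, Y]`
  have hNε1 : 1 ≤ ⌈bigP D ^ (1 + ε)⌉₊ := Nat.one_le_ceil_iff.mpr (Real.rpow_pos_of_pos hP _)
  have hNεδ : ⌈bigP D ^ (1 + ε)⌉₊ ≤ ⌈bigP D ^ (1 + δ)⌉₊ :=
    Nat.ceil_mono (Real.rpow_le_rpow_of_exponent_le hP1 (by linarith))
  have hNδ1 : 1 ≤ ⌈bigP D ^ (1 + δ)⌉₊ := le_trans hNε1 hNεδ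
  have hXs : ⌈bigP D ^ (1 + ε)⌉₊ - 1 + 1 = ⌈bigP D ^ (1 + ε)⌉₊ := Nat.sub_add_cancel hNε1
  have hYs : ⌈bigP D ^ (1 + δ)⌉₊ - 1 + 1 = ⌈bigP D ^ (1 + δ)⌉₊ := Nat.sub_add_cancel hNδ1
  have hXY : ⌈bigP D ^ (1 + ε)⌉₊ - 1 ≤ ⌈bigP D ^ (1 + δ)⌉₊ - 1 := Nat.sub_le_sub_right hNεδ 1
  have hXr : bigP D ^ (1 + 3 * ε / 4) ≤ ((⌈bigP D ^ (1 + ε)⌉₊ - 1 : ℕ) : ℝ) :=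
    rpow_le_ceil_sub_one hP hP1 hε (two_le_bigP_rpow hε hℓ1 hℓ4ε)
  have hYr : (((⌈bigP D ^ (1 + δ)⌉₊ - 1 : ℕ)) : ℝ) ≤ bigP D ^ (1 + δ) := by
    rw [Nat.cast_sub hNδ1, Nat.cast_one]
    have := Nat.ceil_lt_add_one (Real.rpow_nonneg hP.le (1 + δ))
    linarith
  -- the tail block at a sampled pair, and its bound `τ = C(B+V)·v³`, `v = P^{−ε/16}`
  set X : ℕ := ⌈bigP D ^ (1 + ε)⌉₊ - 1 with hXdef
  set Y : ℕ := ⌈bigP D ^ (1 + δ)⌉₊ - 1 with hYdef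
  set t : ((_ : Chr D) × ℂ) → ℂ := fun i =>
    ∑ n ∈ Finset.Ioc X Y, Skeleton.pc χ i.1 n * g (Real.log n / Real.log (Skeleton.bigP D)) *
      (n : ℂ) ^ (-i.2) with htdef
  set v : ℝ := Real.exp (ell D ^ 9 * (-(ε / 16))) with hvdef
  have hv0 : 0 < v := Real.exp_pos _
  have hv1 : v ≤ 1 := by
    rw [hvdef]; apply Real.exp_le_one_iff.mpr
    have : 0 ≤ ell D ^ 9 * (ε / 16) := by positivity
    linarith
  have hPτ : bigP D ^ (-(3 * ε / 4 / 4)) = v ^ 3 := by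
    rw [bigP, ← Real.exp_mul, hvdef, ← Real.exp_nat_mul]; congr 1; push_cast; ring
  have hPη : bigP D ^ (-(ε / 8)) = v ^ 2 := by
    rw [bigP, ← Real.exp_mul, hvdef, ← Real.exp_nat_mul]; congr 1; push_cast; ring
  have hBV : 0 ≤ B + V := add_nonneg hB hV
  have hτ : ∀ i ∈ Skeleton.idx χ, ‖t i‖ ≤ C * (B + V) * v ^ 3 := by
    intro i hi
    have hi' : i.1 ∈ finsetOf (PsiOne χ) ∧ i.2 ∈ finsetOf (zeroSet D i.1) := by
      simpa only [idx, Finset.mem_sigma] using hi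
    have hz : i.2 ∈ zeroSet D i.1 := mem_of_mem_finsetOf hi'.2
    have hre : i.2.re = 1 / 2 := hcrit i hi
    have him : |i.2.im| ≤ 8 * t0 D := abs_im_le_of_mem_zeroSet i.1 hℓ1 hz
    have h1σ : 1 / 2 - 1 / Real.log (bigP D) ≤ i.2.re := by
      rw [hre]; have := one_div_pos.mpr hlogPpos; linarith
    have h2σ : i.2.re ≤ 2 := by rw [hre]; norm_num
    have := hT' i.1 g B V hB hV hgB hvar i.2 h1σ h2σ him X Y hXr hXY hYr
    rw [hPτ] at this
    exact this
  -- the long polynomial = the short one + the block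
  have hsplit : ∀ i : ((_ : Chr D) × ℂ),
      (∑ n ∈ Finset.Ico 1 ⌈bigP D ^ (1 + δ)⌉₊,
          pc χ i.1 n * g (Real.log n / Real.log (bigP D)) * (n : ℂ) ^ (-i.2)) =
        (∑ n ∈ Finset.Ico 1 ⌈bigP D ^ (1 + ε)⌉₊,
          pc χ i.1 n * g (Real.log n / Real.log (bigP D)) * (n : ℂ) ^ (-i.2)) + t i := by
    intro i
    simp only [htdef]
    rw [← Finset.sum_Ico_consecutive _ hNε1 hNεδ, ← hXs, ← hYs, Finset.Ico_add_one_add_one_eq_Ioc]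
  -- the flatness inequality
  have key := abs_sum_mul_norm_sq_perturb_le (Skeleton.idx χ)
    (fun i : ((_ : Chr D) × ℂ) => (cstar c' D i.1 i.2).re * (omegaW D i.2).re)
    (fun i : ((_ : Chr D) × ℂ) => ∑ n ∈ Finset.Ico 1 ⌈bigP D ^ (1 + ε)⌉₊,
      pc χ i.1 n * g (Real.log n / Real.log (bigP D)) * (n : ℂ) ^ (-i.2)) t (pow_pos hv0 2) hτ
  have hdiff : (∑ i ∈ Skeleton.idx χ, (cstar c' D i.1 i.2).re *
        ‖∑ n ∈ Finset.Ico 1 ⌈bigP D ^ (1 + δ)⌉₊,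
            pc χ i.1 n * g (Real.log n / Real.log (bigP D)) * (n : ℂ) ^ (-i.2)‖ ^ 2 * (omegaW D i.2).re) -
      (∑ i ∈ Skeleton.idx χ, (cstar c' D i.1 i.2).re *
        ‖∑ n ∈ Finset.Ico 1 ⌈bigP D ^ (1 + ε)⌉₊,
            pc χ i.1 n * g (Real.log n / Real.log (bigP D)) * (n : ℂ) ^ (-i.2)‖ ^ 2 * (omegaW D i.2).re) =
      ∑ i ∈ Skeleton.idx χ, (cstar c' D i.1 i.2).re * (omegaW D i.2).re *
        (‖(∑ n ∈ Finset.Ico 1 ⌈bigP D ^ (1 + ε)⌉₊,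
              pc χ i.1 n * g (Real.log n / Real.log (bigP D)) * (n : ℂ) ^ (-i.2)) + t i‖ ^ 2 -
          ‖∑ n ∈ Finset.Ico 1 ⌈bigP D ^ (1 + ε)⌉₊,
              pc χ i.1 n * g (Real.log n / Real.log (bigP D)) * (n : ℂ) ^ (-i.2)‖ ^ 2) := by
    rw [← Finset.sum_sub_distrib]
    refine Finset.sum_congr rfl fun i _ => ?_
    rw [hsplit i]; ring
  rw [hdiff, hPη]
  refine key.trans ?_
  -- coefficients: `(C(B+V)v³)²/v² + (C(B+V)v³)² = (B+V)²((Cv³)²/v² + (Cv³)²) ≤ (B+V)² v²` once `2C²v² ≤ 1`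
  have hW0 : 0 ≤ ∑ i ∈ Skeleton.idx χ, |(cstar c' D i.1 i.2).re * (omegaW D i.2).re| :=
    Finset.sum_nonneg fun _ _ => abs_nonneg _
  have hA0 : 0 ≤ ∑ i ∈ Skeleton.idx χ, |(cstar c' D i.1 i.2).re * (omegaW D i.2).re| *
      ‖∑ n ∈ Finset.Ico 1 ⌈bigP D ^ (1 + ε)⌉₊,
          pc χ i.1 n * g (Real.log n / Real.log (bigP D)) * (n : ℂ) ^ (-i.2)‖ ^ 2 :=
    Finset.sum_nonneg fun _ _ => mul_nonneg (abs_nonneg _) (sq_nonneg _)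
  have h2C : 2 * C ^ 2 * v ^ 2 ≤ 1 := two_C_sq_v_sq_le hε hℓ1 hℓC
  have hcoef : (C * v ^ 3) ^ 2 / v ^ 2 + (C * v ^ 3) ^ 2 ≤ v ^ 2 := flat_coef hv0 hv1 h2C
  have hBV2 : 0 ≤ (B + V) ^ 2 := sq_nonneg _
  have hcoef' : (C * (B + V) * v ^ 3) ^ 2 / v ^ 2 + (C * (B + V) * v ^ 3) ^ 2 ≤ (B + V) ^ 2 * v ^ 2 := by
    have h1 : (C * (B + V) * v ^ 3) ^ 2 / v ^ 2 + (C * (B + V) * v ^ 3) ^ 2 =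
        (B + V) ^ 2 * ((C * v ^ 3) ^ 2 / v ^ 2 + (C * v ^ 3) ^ 2) := by ring
    rw [h1]
    exact mul_le_mul_of_nonneg_left hcoef hBV2
  have hfin := mul_le_mul_of_nonneg_right hcoef' hW0
  nlinarith [mul_nonneg hBV2 hW0, hA0, sq_nonneg v]


end Flat

end Literature.NumberTheory.LFunctions.Zhang2022.KnifeEdgeDiscMeanFlat
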